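import Summits.ResolutionOfSingularities.ResolutionOfSingularities.Theorems.FrobeniusClosingSteerSwitchingAssembly
import Summits.ResolutionOfSingularities.ResolutionOfSingularities.Theorems.FrobeniusClosingSteerRsopMonomialStep
import Summits.ResolutionOfSingularities.ResolutionOfSingularities.Theorems.FrobeniusClosingSteerSwitchingSetup
import Summits.ResolutionOfSingularities.ResolutionOfSingularities.Theorems.FrobeniusClosingSteerNotCoarseningArchSeq
import HarnessLib

/-!
# Crux `Steer` (stmt-ResolutionOfSingularities-16345), line `switching_dichotomy` r15: EVENTUAL MONOMIALIZATION
# along a strongly switching point sequence, and the REBIRTH NORMAL FORM of the (α) heart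

OURS (campaign `res-hironaka`, rung L ★L-G4, slot W4.1, chain W4.1; seat `res-L0-w41-stub-4` g3; Theses-free helper for
the holder res-L0-w41-lead-1's line `switching_dichotomy` (skeleton r15) and for the chain planner's words of record
CHAIN v5.4 §B5 «the (α) heart Φ3ᴸˢ/Φ4ᴸˢ at `n = 4` is SS ∧ rank one»; replaces the role of no printed item; NOT a
statement of the manuscript under review [claim: Hironaka2017, status: under-review]; AI-produced, which is weaker than
expert review). The line's vocabulary (`StronglySwitching`, `IsFracOf`, `ToroidalAt`, `GenAt`, `HasProperCoarsening`) is
UNFOLDED into binders (r15 verbatim shapes), so a by-name use in the skeleton is definitional.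

## The engine (E-1)

Let `(K, O)` be a valued field, `A₀ ⊆ O` a finitely generated `k`-subalgebra regular at the centre of `O`, and
`R 0 = (A₀)_{𝔪_O ∩ A₀} ⊆ R 1 ⊆ ⋯` the point sequence of the base along `O` (quadratic transforms along `O`). Assume
* STRONG SWITCHING: every element of `O` which is a fraction of elements of `A₀` lies in some member `R i`, and
* ARCHIMEDEAN on fractions of `A₀` (rank one): `v x < 1`, `y ≠ 0` give `v x ^ n < v y` for some `n`.

**`exists_monomial_of_stronglySwitching`.** Then EVERY non-zero element `b` of EVERY member `R i₀` is, in some later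
member `R N`, a monomial in a part of a regular system of parameters of `R N` times a unit of `R N`.

Proof (the mechanism of [HeinzerEtAl2015, Prop. 4.4], which the landed `stub_switchingAssembly` runs for the single
element `t ^ p − g ^ p`; here it is stated for all elements): if `v b = 1` then `b` is a unit of `R i₀`; otherwise pick a
regular parameter `x₀` of `R i₀` (`exists_isRsopPart_one`), archimedeanity gives `v x₀ ^ n < v b`, so
`c := x₀ ^ n / b ∈ O ∩ Frac A₀` lies in some member (strong switching), hence `b · c = x₀ ^ n` in `R N`,
`N := i₀ + N₁`, where `x₀` is a monomial in a part of a regular system of parameters times a unit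
(`exists_monomial_along`, iterating the landed one-step lemma `stub_rsopMonomialStep` = HLOST Lemma 2.7); a divisor of a
product of powers of the prime elements `z_l` is such a product times a unit (`exists_monomial_of_mul_eq`).

## The rebirth normal form (E-2), for the frontier residuals Φ3ᴸˢ / Φ4ᴸˢ / `SeqLogFinalSS`

**`exists_pow_mul_unit_of_forall_not_toroidal`.** If moreover `b` is NEVER toroidal with an exponent prime to `p` at any
member (the E2 disjunct of `LogFinalAt` negated — exactly what the residuals' hypothesis `∀ M, ¬ LogExitAt (R M) p A₀ t`
says about the radicand `b = t₂ ^ p` of any `t₂ ∉ Frac A₀`), then all exponents of the eventual monomial are divisible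
by `p`, i.e. `b = m ^ p · u` in some member `R N` with `m ∈ R N` and `u` a unit of `R N`.

**`exists_genAt_unit_radicand`.** Consequently, inside the (α) heart every generator `t₂` of the torsor over a member
`R i₀` (`t₂ ^ p ∈ R i₀`, `t ∈ R i₀[t₂]`, `t₂ ∉ Frac A₀`) is REBORN FROM A UNIT: at some later member `R N` the element
`t₃ := t₂ / m` is again a generator (`t ∈ R N[t₃]`) and its radicand `t₃ ^ p = u` is a UNIT of `R N` (res-L0-w41-tri-2's
«the radicand is reborn of order `p` from a unit», made universal under SS ∧ rank one ∧ never-log-final).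

Rank-one wrappers (`…_of_not_hasProperCoarsening`) read the archimedean hypothesis off
`¬ SteerRankThinness.HasProperCoarsening O` via `rankOne_of_not_hasProperCoarsening` and
`exists_pow_valuation_lt_of_rankOne` (both in the tree), which is how r15 states rank one at `n = 4`.

Sources: W. Heinzer, K. A. Loper, B. Olberding, H. Schoutens, M. Toeniskoetter, *Ideal theory of infinite directed
unions of local quadratic transforms*, J. Algebra 474 (2017) = arXiv:1505.06445, Lemma 2.7, Prop. 4.4, Discussion 4.2;
D. Shannon, *Monoidal transforms of regular local rings*, Amer. J. Math. 95 (1973).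
-/

-- `Summit.<S>.<S>.…` duplicates the summit name by design (single-problem summit).
set_option linter.dupNamespace false

open IsLocalRing
open Literature.AlgebraicGeometry.Resolution

namespace Summit.ResolutionOfSingularities.ResolutionOfSingularities.Theorems.SwitchingDichotomy

namespace EventualMonomial

open Summit.ResolutionOfSingularities.ResolutionOfSingularities.Theorems.SteerRankThinness
  (HasProperCoarsening rankOne_of_not_hasProperCoarsening)

variable {k K : Type} [Field k] [Field K] [Algebra k K]

/-! ## E-1 · eventual monomialization of elements -/

/-- **Eventual monomialization along a strongly switching point sequence (rank one).** Along the point sequence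
`R` of a base `A₀ ⊆ O` regular at the centre of `O`, if the sequence is strongly switching (it exhausts `O ∩ Frac A₀`)
and `O` is archimedean on fractions of `A₀`, then every non-zero element `b` of a member `R i₀` equals, in some later
member `R N`, a monomial in a part `z` of a regular system of parameters of `R N` times a unit of `R N`.
[cite: HeinzerEtAl2015, Prop. 4.4] [cite: HeinzerEtAl2015, Lemma 2.7] -/
theorem exists_monomial_of_stronglySwitching (O : ValuationSubring K) (A₀ : Subalgebra k K)
    (h₀ : A₀.toSubring ≤ O.toSubring)
    (hreg : IsRegularLocalRing (Localization.AtPrime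
      (Ideal.comap (Subring.inclusion h₀) (IsLocalRing.maximalIdeal O))))
    (R : ℕ → Subring K) (hR0 : R 0 = locAtCentre A₀.toSubring O)
    (hstep : ∀ i, IsQuadraticTransformAlong O (R i) (R (i + 1)))
    (hSS : ∀ x : K, x ∈ O → (∃ y ∈ A₀, ∃ z ∈ A₀, z ≠ 0 ∧ x = y / z) → ∃ i, x ∈ R i)
    (hArch : ∀ x y : K, (∃ a ∈ A₀, ∃ b ∈ A₀, b ≠ 0 ∧ x = a / b) →
      (∃ a ∈ A₀, ∃ b ∈ A₀, b ≠ 0 ∧ y = a / b) → y ≠ 0 → O.valuation x < 1 →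
      ∃ n : ℕ, O.valuation x ^ n < O.valuation y)
    (i₀ : ℕ) (b : K) (hbR : b ∈ R i₀) (hb0 : b ≠ 0) :
    ∃ N : ℕ, i₀ ≤ N ∧ ∃ (_ : IsLocalRing (R N)) (s : ℕ) (z : Fin s → R N), IsRsopPart z ∧
      ∃ (e : Fin s → ℕ) (u : R N), IsUnit u ∧ b = (∏ l, ((z l : R N) : K) ^ e l) * (u : K) := by
  classical
  -- the members of the sequence: regular local, dominated by `O`, made of fractions of `A₀`
  have hreg₀ : IsRegularLocalRing (R 0) := by
    rw [hR0]
    exact (isRegularLocalRing_locAtCentre_iff h₀).mpr hreg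
  haveI hRreg : ∀ i, IsRegularLocalRing (R i) := isRegularLocalRing_sequence hreg₀ hstep
  have hdom₀ : SubringDominates (R 0) O.toSubring := by
    rw [hR0]
    exact subringDominates_locAtCentre h₀
  have hRdom : ∀ i, SubringDominates (R i) O.toSubring := fun i =>
    (sequence_dominates hdom₀ hstep i).1
  have hmono : Monotone R := sequence_monotone hstep
  have hRO : ∀ i, R i ≤ O.toSubring := fun i => (hRdom i).1
  have hmax : ∀ i (a : R i), a ∈ maximalIdeal (R i) ↔ O.valuation (a : K) < 1 := fun i =>
    (subringDominates_valuationSubring_iff (hRO i)).mp (hRdom i)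
  have hF0 : R 0 ≤ (Subfield.closure ((A₀.toSubring : Subring K) : Set K)).toSubring := by
    rw [hR0]
    exact locAtCentre_le_subfield O fun x hx => Subfield.subset_closure hx
  have hRfrac : ∀ i, ∀ x ∈ R i, ∃ y ∈ A₀, ∃ z ∈ A₀, z ≠ 0 ∧ x = y / z := fun i x hx => by
    obtain ⟨y, hy, z, hz, hz0, hxyz⟩ :=
      exists_div_eq_of_mem_subfieldClosure (sequence_le_subfield hF0 hstep i hx)
    exact ⟨y, hy, z, hz, hz0, hxyz⟩
  -- the maximal ideal of `R i₀` is non-zero (a quadratic transform issues from it)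
  have hne : maximalIdeal (R i₀) ≠ ⊥ := by
    obtain ⟨hloc, x₀, hx₀m, hx₀0, -, -⟩ := (hstep i₀).exists_eq_locAtCentre
    intro hbot
    have hx₀m' : x₀ ∈ maximalIdeal (R i₀) := by convert hx₀m
    rw [hbot, Ideal.mem_bot] at hx₀m'
    exact hx₀0 hx₀m'
  -- a regular parameter `x₀ := z₀ 0` of `R i₀`
  obtain ⟨z₀, hz₀⟩ := exists_isRsopPart_one hne
  have hx₀0 : ((z₀ 0 : R i₀) : K) ≠ 0 := fun h => hz₀.ne_zero 0 (Subtype.ext h)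
  have hvx₀ : O.valuation ((z₀ 0 : R i₀) : K) < 1 := (hmax i₀ _).mp (hz₀.mem_maximalIdeal 0)
  -- case `v b = 1`: `b` is a unit of `R i₀`, a monomial with exponent `0`
  by_cases hvb : O.valuation b < 1
  swap
  · have hvb1 : O.valuation b = 1 :=
      le_antisymm ((O.valuation_le_one_iff b).mpr (hRO i₀ hbR)) (not_lt.mp hvb)
    refine ⟨i₀, le_rfl, inferInstance, 1, z₀, hz₀, fun _ => 0, ⟨b, hbR⟩, ?_, by simp⟩
    rw [isUnit_subring_iff_inv_mem]
    exact ⟨hb0, (hRdom i₀).2 b hbR ((O.valuation_le_one_iff _).mp (by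
      rw [map_inv₀, hvb1, inv_one]))⟩
  -- the archimedean step: `c := x₀ ^ n / b ∈ O ∩ Frac A₀` lies in some member `R N₁`
  obtain ⟨n, hn⟩ := hArch _ b (hRfrac i₀ _ (z₀ 0).2) (hRfrac i₀ b hbR) hb0 hvx₀
  have hvc : O.valuation (((z₀ 0 : R i₀) : K) ^ n / b) < 1 := by
    rw [map_div₀, map_pow, div_lt_one₀ ((Valuation.pos_iff _).mpr hb0)]
    exact hn
  have hcO : ((z₀ 0 : R i₀) : K) ^ n / b ∈ O := (O.valuation_le_one_iff _).mp hvc.le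
  have hcfrac : ∃ y ∈ A₀, ∃ z ∈ A₀, z ≠ 0 ∧ ((z₀ 0 : R i₀) : K) ^ n / b = y / z := by
    obtain ⟨y₁, hy₁, w₁, hw₁, hw₁0, h₁⟩ := hRfrac i₀ _ (z₀ 0).2
    obtain ⟨y₂, hy₂, w₂, hw₂, hw₂0, h₂⟩ := hRfrac i₀ b hbR
    have hy₂0 : y₂ ≠ 0 := by
      rintro rfl
      exact hb0 (by rw [h₂, zero_div])
    refine ⟨y₁ ^ n * w₂, A₀.mul_mem (pow_mem hy₁ n) hw₂, w₁ ^ n * y₂,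
      A₀.mul_mem (pow_mem hw₁ n) hy₂, mul_ne_zero (pow_ne_zero n hw₁0) hy₂0, ?_⟩
    rw [h₁, h₂, div_pow, div_div_eq_mul_div, div_mul_eq_mul_div, div_div]
  obtain ⟨N₁, hcN₁⟩ := hSS _ hcO hcfrac
  -- everything in `R N`, `N := i₀ + N₁`, where `x₀` is a monomial times a unit
  have hbase : ∃ (s : ℕ) (z : Fin s → R i₀), IsRsopPart z ∧ ∃ (e : Fin s → ℕ) (u : R i₀),
      IsUnit u ∧ ((z₀ 0 : R i₀) : K) = (∏ l, ((z l : R i₀) : K) ^ e l) * (u : K) :=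
    ⟨1, z₀, hz₀, fun _ => 1, 1, isUnit_one, by simp⟩
  obtain ⟨s, zN, hzN, eN, uN, huN, hx₀eq⟩ :=
    exists_monomial_along (stub_rsopMonomialStep) O R hstep hRdom i₀ _ hbase N₁
  have hcN : ((z₀ 0 : R i₀) : K) ^ n / b ∈ R (i₀ + N₁) := hmono (Nat.le_add_left N₁ i₀) hcN₁
  have hbN : b ∈ R (i₀ + N₁) := hmono (Nat.le_add_right i₀ N₁) hbR
  -- `b · c = x₀ ^ n` is a monomial times a unit, hence so is `b`
  have hbc : b * (((z₀ 0 : R i₀) : K) ^ n / b) =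
      (∏ l, ((zN l : R (i₀ + N₁)) : K) ^ (n * eN l)) * ((uN ^ n : R (i₀ + N₁)) : K) := by
    rw [mul_div_cancel₀ _ hb0, hx₀eq, mul_pow, ← Finset.prod_pow, SubmonoidClass.coe_pow]
    refine congrArg (· * _) (Finset.prod_congr rfl fun l _ => ?_)
    rw [← pow_mul, mul_comm]
  obtain ⟨m, u', hu', hbm⟩ :=
    exists_monomial_of_mul_eq hzN (fun l => n * eN l) hbN hcN (huN.pow n) hbc
  exact ⟨i₀ + N₁, Nat.le_add_right i₀ N₁, inferInstance, s, zN, hzN, m, u', hu', hbm⟩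

/-! ## E-2 · the rebirth normal form: never toroidal with an exponent prime to `p` ⇒ `p`-th power times unit -/

/-- Pure algebra: a monomial all of whose exponents are divisible by `p` is a `p`-th power. [folklore] -/
theorem prod_pow_eq_pow_of_forall_dvd {S : Subring K} {s : ℕ} (z : Fin s → S) {p : ℕ}
    {e : Fin s → ℕ} (h : ∀ l, p ∣ e l) :
    (∏ l, ((z l : S) : K) ^ e l) = (((∏ l, z l ^ (e l / p) : S) : K)) ^ p := by
  push_cast
  rw [← Finset.prod_pow]
  exact Finset.prod_congr rfl fun l _ => by rw [← pow_mul, Nat.div_mul_cancel (h l)]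

/-- **Rebirth normal form.** Under strong switching and archimedeanity (as in
`exists_monomial_of_stronglySwitching`), a non-zero element `b` of a member `R i₀` which at NO member `R N` is a
monomial in a part of a regular system of parameters times a unit WITH SOME EXPONENT PRIME TO `p` (the negation of the
toroidal exit `ToroidalAt p (R N) b` of the line, unfolded) is a `p`-TH POWER TIMES A UNIT in some later member:
`b = m ^ p · u`, `m ∈ R N`, `u ∈ (R N)ˣ`. For the radicand `b = t₂ ^ p` of a generator this is the universal form of
«the radicand is reborn from a unit». OURS. [cite: HeinzerEtAl2015, Prop. 4.4] [folklore] -/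
theorem exists_pow_mul_unit_of_forall_not_toroidal (p : ℕ) (O : ValuationSubring K)
    (A₀ : Subalgebra k K) (h₀ : A₀.toSubring ≤ O.toSubring)
    (hreg : IsRegularLocalRing (Localization.AtPrime
      (Ideal.comap (Subring.inclusion h₀) (IsLocalRing.maximalIdeal O))))
    (R : ℕ → Subring K) (hR0 : R 0 = locAtCentre A₀.toSubring O)
    (hstep : ∀ i, IsQuadraticTransformAlong O (R i) (R (i + 1)))
    (hSS : ∀ x : K, x ∈ O → (∃ y ∈ A₀, ∃ z ∈ A₀, z ≠ 0 ∧ x = y / z) → ∃ i, x ∈ R i)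
    (hArch : ∀ x y : K, (∃ a ∈ A₀, ∃ b ∈ A₀, b ≠ 0 ∧ x = a / b) →
      (∃ a ∈ A₀, ∃ b ∈ A₀, b ≠ 0 ∧ y = a / b) → y ≠ 0 → O.valuation x < 1 →
      ∃ n : ℕ, O.valuation x ^ n < O.valuation y)
    (i₀ : ℕ) (b : K) (hbR : b ∈ R i₀) (hb0 : b ≠ 0)
    (hnt : ∀ (N : ℕ) (_ : IsLocalRing (R N)), ¬ ∃ (s : ℕ) (z : Fin s → R N), IsRsopPart z ∧
      ∃ (m : Fin s → ℕ), (∃ l, ¬ p ∣ m l) ∧ ∃ u : R N, IsUnit u ∧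
        b = (∏ l, ((z l : R N) : K) ^ m l) * (u : K)) :
    ∃ N : ℕ, i₀ ≤ N ∧ ∃ (m : K) (_ : m ∈ R N) (u : R N), IsUnit u ∧ m ≠ 0 ∧
      b = m ^ p * (u : K) := by
  classical
  obtain ⟨N, hN, hloc, s, z, hz, e, u, hu, hbe⟩ :=
    exists_monomial_of_stronglySwitching O A₀ h₀ hreg R hR0 hstep hSS hArch i₀ b hbR hb0
  -- all exponents are divisible by `p`, else `b` would be toroidal at `R N`
  have hall : ∀ l, p ∣ e l := by
    by_contra hcon
    push Not at hcon
    exact hnt N hloc ⟨s, z, hz, e, hcon, u, hu, hbe⟩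
  refine ⟨N, hN, ((∏ l, z l ^ (e l / p) : R N) : K), SetLike.coe_mem _, u, hu, ?_, ?_⟩
  · intro h0
    apply hb0
    rw [hbe, prod_pow_eq_pow_of_forall_dvd z hall, h0]
    by_cases hp : p = 0
    · -- `p = 0`: every exponent is `0`, the monomial is `1 ≠ 0`; unreachable but harmless
      exfalso
      have h1 : ((∏ l, z l ^ (e l / p) : R N) : K) = 1 := by
        push_cast
        exact Finset.prod_eq_one fun l _ => by rw [hp, Nat.div_zero, pow_zero]
      exact one_ne_zero (h1.symm.trans h0)
    · rw [zero_pow hp, zero_mul]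
  · rw [hbe, prod_pow_eq_pow_of_forall_dvd z hall]

/-! ## E-2′ · generators are reborn from units -/

/-- **Every generator is reborn from a unit radicand** (inside SS ∧ rank one ∧ never-toroidal). If `t₂` is a
generator of the torsor of `t` over the member `R i₀` (`t₂ ^ p ∈ R i₀` and `t ∈ R i₀[t₂]`, the line's `GenAt`
unfolded; `t₂ ≠ 0`) whose radicand `t₂ ^ p` is never toroidal with an exponent prime to `p` at any member, then at
some later member `R N` there is a generator `t₃` (`t ∈ R N[t₃]`) with `t₂ = m · t₃`, `m ∈ R N`, whose radicand
`t₃ ^ p` is a UNIT of `R N`. OURS. [cite: HeinzerEtAl2015, Prop. 4.4] [folklore] -/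
theorem exists_genAt_unit_radicand (p : ℕ) (O : ValuationSubring K)
    (A₀ : Subalgebra k K) (h₀ : A₀.toSubring ≤ O.toSubring)
    (hreg : IsRegularLocalRing (Localization.AtPrime
      (Ideal.comap (Subring.inclusion h₀) (IsLocalRing.maximalIdeal O))))
    (R : ℕ → Subring K) (hR0 : R 0 = locAtCentre A₀.toSubring O)
    (hstep : ∀ i, IsQuadraticTransformAlong O (R i) (R (i + 1)))
    (hSS : ∀ x : K, x ∈ O → (∃ y ∈ A₀, ∃ z ∈ A₀, z ≠ 0 ∧ x = y / z) → ∃ i, x ∈ R i)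
    (hArch : ∀ x y : K, (∃ a ∈ A₀, ∃ b ∈ A₀, b ≠ 0 ∧ x = a / b) →
      (∃ a ∈ A₀, ∃ b ∈ A₀, b ≠ 0 ∧ y = a / b) → y ≠ 0 → O.valuation x < 1 →
      ∃ n : ℕ, O.valuation x ^ n < O.valuation y)
    (t : K) (i₀ : ℕ) (t₂ : K) (ht₂0 : t₂ ≠ 0) (ht₂R : t₂ ^ p ∈ R i₀)
    (hgen : t ∈ Subring.closure (insert t₂ (R i₀ : Set K)))
    (hnt : ∀ (N : ℕ) (_ : IsLocalRing (R N)), ¬ ∃ (s : ℕ) (z : Fin s → R N), IsRsopPart z ∧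
      ∃ (m : Fin s → ℕ), (∃ l, ¬ p ∣ m l) ∧ ∃ u : R N, IsUnit u ∧
        t₂ ^ p = (∏ l, ((z l : R N) : K) ^ m l) * (u : K)) :
    ∃ N : ℕ, i₀ ≤ N ∧ ∃ (m : K) (_ : m ∈ R N) (t₃ : K) (u : R N), IsUnit u ∧
      t₂ = m * t₃ ∧ t₃ ^ p = (u : K) ∧ t₃ ^ p ∈ R N ∧
      t ∈ Subring.closure (insert t₃ (R N : Set K)) := by
  classical
  obtain ⟨N, hN, m, hmR, u, hu, hm0, hbe⟩ :=
    exists_pow_mul_unit_of_forall_not_toroidal p O A₀ h₀ hreg R hR0 hstep hSS hArch i₀ (t₂ ^ p)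
      ht₂R (pow_ne_zero p ht₂0) hnt
  have hmono : Monotone R := sequence_monotone hstep
  have ht₃p : (t₂ / m) ^ p = (u : K) := by
    rw [div_pow, hbe, mul_div_cancel_left₀ _ (pow_ne_zero p hm0)]
  refine ⟨N, hN, m, hmR, t₂ / m, u, hu, (mul_div_cancel₀ t₂ hm0).symm, ht₃p,
    ht₃p ▸ u.2, ?_⟩
  -- `t ∈ R i₀[t₂] ⊆ R N[t₂ / m]` since `t₂ = m · (t₂ / m)` with `m ∈ R N`
  have hsub : insert t₂ (R i₀ : Set K) ⊆ Subring.closure (insert (t₂ / m) (R N : Set K)) := by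
    rintro x (rfl | hx)
    · have h := Subring.mul_mem (Subring.closure (insert (x / m) (R N : Set K)))
        (Subring.subset_closure (Set.mem_insert_of_mem _ hmR))
        (Subring.subset_closure (Set.mem_insert (x / m) (R N : Set K)))
      rwa [mul_div_cancel₀ x hm0] at h
    · exact Subring.subset_closure (Set.mem_insert_of_mem _ (hmono hN hx))
  exact Subring.closure_le.mpr hsub hgen

/-! ## Rank-one wrappers (r15 reads rank one at `n = 4` as `¬ HasProperCoarsening O`) -/

/-- The archimedean hypothesis of this file from «no proper coarsening» (rank one), via the tree's
`rankOne_of_not_hasProperCoarsening` and `exists_pow_valuation_lt_of_rankOne`. [cite: HeinzerEtAl2015, Remark 2.4]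
[folklore] -/
theorem arch_of_not_hasProperCoarsening (O : ValuationSubring K) (hO : O ≠ ⊤)
    (hnc : ¬ HasProperCoarsening O) (A₀ : Subalgebra k K) :
    ∀ x y : K, (∃ a ∈ A₀, ∃ b ∈ A₀, b ≠ 0 ∧ x = a / b) →
      (∃ a ∈ A₀, ∃ b ∈ A₀, b ≠ 0 ∧ y = a / b) → y ≠ 0 → O.valuation x < 1 →
      ∃ n : ℕ, O.valuation x ^ n < O.valuation y :=
  fun _ _ _ _ hy hx =>
    exists_pow_valuation_lt_of_rankOne O (rankOne_of_not_hasProperCoarsening O hO hnc) hx hy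

/-- **E-1 at rank one.** `exists_monomial_of_stronglySwitching` with the archimedean hypothesis read off
`¬ HasProperCoarsening O`. [cite: HeinzerEtAl2015, Prop. 4.4] [folklore] -/
theorem exists_monomial_of_not_hasProperCoarsening (O : ValuationSubring K) (hO : O ≠ ⊤)
    (hnc : ¬ HasProperCoarsening O) (A₀ : Subalgebra k K) (h₀ : A₀.toSubring ≤ O.toSubring)
    (hreg : IsRegularLocalRing (Localization.AtPrime
      (Ideal.comap (Subring.inclusion h₀) (IsLocalRing.maximalIdeal O))))
    (R : ℕ → Subring K) (hR0 : R 0 = locAtCentre A₀.toSubring O)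
    (hstep : ∀ i, IsQuadraticTransformAlong O (R i) (R (i + 1)))
    (hSS : ∀ x : K, x ∈ O → (∃ y ∈ A₀, ∃ z ∈ A₀, z ≠ 0 ∧ x = y / z) → ∃ i, x ∈ R i)
    (i₀ : ℕ) (b : K) (hbR : b ∈ R i₀) (hb0 : b ≠ 0) :
    ∃ N : ℕ, i₀ ≤ N ∧ ∃ (_ : IsLocalRing (R N)) (s : ℕ) (z : Fin s → R N), IsRsopPart z ∧
      ∃ (e : Fin s → ℕ) (u : R N), IsUnit u ∧ b = (∏ l, ((z l : R N) : K) ^ e l) * (u : K) :=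
  exists_monomial_of_stronglySwitching O A₀ h₀ hreg R hR0 hstep hSS
    (arch_of_not_hasProperCoarsening O hO hnc A₀) i₀ b hbR hb0

/-- **E-2′ at rank one.** `exists_genAt_unit_radicand` with the archimedean hypothesis read off
`¬ HasProperCoarsening O`: inside the (α) heart of r15 (strongly switching, no proper coarsening, no member toroidally
log-final) every generator of the torsor over any member is reborn, at a later member, from a UNIT radicand.
[cite: HeinzerEtAl2015, Prop. 4.4] [folklore] -/
theorem exists_genAt_unit_radicand_of_not_hasProperCoarsening (p : ℕ)
    (O : ValuationSubring K) (hO : O ≠ ⊤) (hnc : ¬ HasProperCoarsening O)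
    (A₀ : Subalgebra k K) (h₀ : A₀.toSubring ≤ O.toSubring)
    (hreg : IsRegularLocalRing (Localization.AtPrime
      (Ideal.comap (Subring.inclusion h₀) (IsLocalRing.maximalIdeal O))))
    (R : ℕ → Subring K) (hR0 : R 0 = locAtCentre A₀.toSubring O)
    (hstep : ∀ i, IsQuadraticTransformAlong O (R i) (R (i + 1)))
    (hSS : ∀ x : K, x ∈ O → (∃ y ∈ A₀, ∃ z ∈ A₀, z ≠ 0 ∧ x = y / z) → ∃ i, x ∈ R i)
    (t : K) (i₀ : ℕ) (t₂ : K) (ht₂0 : t₂ ≠ 0) (ht₂R : t₂ ^ p ∈ R i₀)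
    (hgen : t ∈ Subring.closure (insert t₂ (R i₀ : Set K)))
    (hnt : ∀ (N : ℕ) (_ : IsLocalRing (R N)), ¬ ∃ (s : ℕ) (z : Fin s → R N), IsRsopPart z ∧
      ∃ (m : Fin s → ℕ), (∃ l, ¬ p ∣ m l) ∧ ∃ u : R N, IsUnit u ∧
        t₂ ^ p = (∏ l, ((z l : R N) : K) ^ m l) * (u : K)) :
    ∃ N : ℕ, i₀ ≤ N ∧ ∃ (m : K) (_ : m ∈ R N) (t₃ : K) (u : R N), IsUnit u ∧
      t₂ = m * t₃ ∧ t₃ ^ p = (u : K) ∧ t₃ ^ p ∈ R N ∧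
      t ∈ Subring.closure (insert t₃ (R N : Set K)) :=
  exists_genAt_unit_radicand p O A₀ h₀ hreg R hR0 hstep hSS
    (arch_of_not_hasProperCoarsening O hO hnc A₀) t i₀ t₂ ht₂0 ht₂R hgen hnt

end EventualMonomial

end Summit.ResolutionOfSingularities.ResolutionOfSingularities.Theorems.SwitchingDichotomy
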